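import Literature.AlgebraicGeometry.HodgeTheory.RegularImmersionConormal
import Literature.AlgebraicGeometry.Modules.VectorBundleFiniteLocallyFree
import HarnessLib

/-!
# [OURS · L1 W4.5(b) · LINE (T-j)-PROOF · BRICK B4, sub-brick (B4-a1)] The ideal module of a CODIMENSION-ONE regular immersion is a
# LINE BUNDLE (free of rank one on every affine open where the ideal is generated by a non-zero-divisor)

Crux chain w45b (cell `res-hironaka`), EL♮(3) stmt-ResolutionOfSingularities-20148, LINE (T-j)-PROOF of F-102 `GenusZeroOverCompleteDVR`
(res-L1-w45b-lead-2 g3, skeleton `L/res-L1-w45b-lead-2/F102Skeleton.lean` v3 1683bb741349c142), BRICK B4 `exists_coordinate_functions`, step (B4-a)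
«`𝓘_{D_j}` is a line bundle» (res-L1-type-o6 g30). HONEST FRAMING: OURS glue over the tree's Modules/HodgeTheory library
(`Deformation.idealModule`, `HodgeTheory.IsRegularImmersionOfCodim`, `Modules/KernelFiniteLocallyFree.nonempty_free_iso_over_of_basis`,
`Modules/SectionsExact`); NOT a statement of any manuscript; AI-written, gate-checked, weaker than expert review. No `sorry`; standard axioms;
DEF-FREE. `--supports stmt-ResolutionOfSingularities-20148 --as helper`.

* `nonempty_basis_sections_idealModule_of_span_singleton` — on an affine open `V` with `𝓘(V) = i.ker(V) = (x)`, `x` a non-zero-divisor of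
  `Γ(V, 𝒪_X)`, the sections `Γ(V, 𝓘)` of the ideal module `𝓘 = idealModule i` form a FREE `Γ(V, 𝒪_X)`-module of rank one, with basis the
  section reading to `x` (reading `Γ(V, 𝓘) ↪ Γ(V, 𝒪_X)` by `Modules/SectionsExact`, image `= i.ker.ideal V` by `app_idealModuleι_eq_zero`);
* `nonempty_free_iso_over_idealModule_of_span_singleton` — hence `𝓘|_V ≅ 𝒪_V` (`nonempty_free_iso_over_of_basis`, `𝓘` coherent);
* **`isVectorBundle_idealModule_of_isRegularImmersionOfCodim_one`** — for a regular immersion of codimension one into a locally Noetherian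
  scheme, `idealModule i` is a VECTOR BUNDLE (rank one on the charts of the definition; `≅ 𝒪` off the closed image, where the ideal is `(1)`).
-/

set_option linter.dupNamespace false -- mandated namespace `Summit.<Summit>.<Problem>` of this single-conjunct summit

noncomputable section

open CategoryTheory CategoryTheory.Limits AlgebraicGeometry Opposite TopologicalSpace
open Literature.AlgebraicGeometry.Modules Literature.AlgebraicGeometry.Morphisms
open Literature.AlgebraicGeometry.Deformation Literature.AlgebraicGeometry.Motives Literature.AlgebraicGeometry.HodgeTheory

universe u

namespace Summit.ResolutionOfSingularities.ResolutionOfSingularities.Cruxes.EquisingularLiftNat.F102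

variable {X Z : Scheme.{u}} (i : Z ⟶ X)

/-- **Sections of the ideal module on an affine open with principal non-zero-divisor ideal form a free module of rank one.**
For a closed immersion `i : Z ⟶ X` into a locally Noetherian `X`, an affine open `V` and `x ∈ Γ(V, 𝒪_X)` a non-zero-divisor with
`(x) = i.ker(V)`: a basis of `Γ(V, idealModule i)` indexed by `PUnit`, whose element reads to `x`. [OURS · glue] -/
theorem nonempty_basis_sections_idealModule_of_span_singleton [IsLocallyNoetherian X] [IsClosedImmersion i]
    (V : X.affineOpens) (x : Γ(X, (V : X.Opens))) (hx : ∀ a : Γ(X, (V : X.Opens)), a * x = 0 → a = 0)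
    (hI : Ideal.span {x} = i.ker.ideal V) :
    ∃ b : Module.Basis PUnit.{u + 1} Γ(X, (V : X.Opens)) Γ(idealModule i, (V : X.Opens)),
      toRing (idealModuleι i) (V : X.Opens) (b PUnit.unit) = x := by
  classical
  set M : X.Modules := idealModule i with hMdef
  set φ : Γ(X, (V : X.Opens)) →+* Γ(Z, i ⁻¹ᵁ (V : X.Opens)) := (i.app (V : X.Opens)).hom with hφ
  have hker : i.ker.ideal V = RingHom.ker φ := Scheme.Hom.ker_apply i V
  -- the reading `ρ : Γ(V, 𝓘) → Γ(V, 𝒪_X)` (injective, linear)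
  let ρ : Γ(M, (V : X.Opens)) → Γ(X, (V : X.Opens)) := toRing (idealModuleι i) (V : X.Opens)
  have hρinj : Function.Injective ρ := kernel_ι_app_injective (structureModuleMap i) (V : X.Opens)
  have hρsmul : ∀ (a : Γ(X, (V : X.Opens))) (t : Γ(M, (V : X.Opens))), ρ (a • t) = a * ρ t :=
    fun a t => toRing_smul (idealModuleι i) (V : X.Opens) a t
  have hρadd : ∀ s t : Γ(M, (V : X.Opens)), ρ (s + t) = ρ s + ρ t := fun s t => toRing_add (idealModuleι i) (V : X.Opens) s t
  -- the section `s ∈ Γ(V, 𝓘)` reading to `x`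
  have hx0 : (structureModuleMap i).app (V : X.Opens) x = 0 := by
    have hj : x ∈ RingHom.ker φ := by
      rw [← hker, ← hI]
      exact Ideal.subset_span rfl
    exact hj
  obtain ⟨s, hs⟩ := exists_kernel_ι_app_eq (structureModuleMap i) (V : X.Opens) x hx0
  have hρs : ρ s = x := hs
  -- generation: every section is a multiple of `s`
  have hgen : ∀ m : Γ(M, (V : X.Opens)), ∃ a : Γ(X, (V : X.Opens)), m = a • s := by
    intro m
    have hm : ρ m ∈ Ideal.span {x} := by
      rw [hI, hker]
      exact app_idealModuleι_eq_zero i (V : X.Opens) m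
    obtain ⟨a, ha⟩ := Ideal.mem_span_singleton'.mp hm
    refine ⟨a, hρinj ?_⟩
    rw [hρsmul, hρs, ha]
  -- independence: `a • s = 0 ⇒ a x = 0 ⇒ a = 0`
  have hind : LinearIndependent Γ(X, (V : X.Opens)) (fun _ : PUnit.{u + 1} => s) := by
    rw [Fintype.linearIndependent_iff]
    intro g hg j
    obtain rfl : j = PUnit.unit := rfl
    have h1 : g PUnit.unit • s = 0 := by simpa using hg
    apply hx
    have h := congrArg ρ h1
    rw [hρsmul, hρs] at h
    rw [h]
    exact toRing_zero (idealModuleι i) (V : X.Opens)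
  have hspan : ⊤ ≤ Submodule.span Γ(X, (V : X.Opens)) (Set.range fun _ : PUnit.{u + 1} => s) := by
    rintro m -
    obtain ⟨a, rfl⟩ := hgen m
    exact Submodule.smul_mem _ a (Submodule.subset_span ⟨PUnit.unit, rfl⟩)
  exact ⟨Module.Basis.mk hind hspan, by rw [Module.Basis.mk_apply]; exact hρs⟩

/-- **The ideal module is free of rank one on such an affine open**: `(idealModule i)|_V ≅ 𝒪_V^{PUnit}`. [OURS · glue] -/
theorem nonempty_free_iso_over_idealModule_of_span_singleton [IsLocallyNoetherian X] [IsClosedImmersion i]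
    (V : X.affineOpens) (x : Γ(X, (V : X.Opens))) (hx : ∀ a : Γ(X, (V : X.Opens)), a * x = 0 → a = 0)
    (hI : Ideal.span {x} = i.ker.ideal V) :
    Nonempty (SheafOfModules.free PUnit.{u + 1} ≅ (idealModule i).over (V : X.Opens)) := by
  obtain ⟨b, -⟩ := nonempty_basis_sections_idealModule_of_span_singleton i V x hx hI
  exact nonempty_free_iso_over_of_basis _ (coh_idealModule i).loc V.2 b

/-- **(B4-a1) The ideal module of a codimension-one regular immersion is a line bundle.**  For `i : Z ⟶ X` a regular immersion of codimension
`1` (the ideal is generated near each point of the image by ONE weakly regular element) into a locally Noetherian `X`, `idealModule i` is a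
vector bundle (finite locally free): free of rank one on the charts of the definition, and `≅ 𝒪` on affine opens missing the (closed) image,
where the ideal is the unit ideal. [OURS · glue] toward `F102.exists_coordinate_functions`; NOT a statement of the manuscript. -/
theorem isVectorBundle_idealModule_of_isRegularImmersionOfCodim_one [IsLocallyNoetherian X] (h : IsRegularImmersionOfCodim i 1) :
    IsVectorBundle (idealModule i) := by
  classical
  haveI : IsClosedImmersion i := h.isClosedImmersion
  refine IsFiniteLocallyFree.isVectorBundle fun y => ?_
  by_cases hy : y ∈ Set.range i.base
  · -- a chart of the definition
    obtain ⟨z, rfl⟩ := hy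
    obtain ⟨V, hzV, rs, hlen, hreg, hI⟩ := h.2 z
    -- the one generator
    obtain ⟨x, hrs⟩ : ∃ x, rs = [x] := by
      match rs, hlen with
      | [x], _ => exact ⟨x, rfl⟩
    subst hrs
    have hx : ∀ a : Γ(X, (V : X.Opens)), a * x = 0 → a = 0 := by
      intro a ha
      have h1 := (RingTheory.Sequence.isWeaklyRegular_cons_iff' (M := Γ(X, (V : X.Opens))) x []).mp hreg
      have h2 : IsSMulRegular Γ(X, (V : X.Opens)) x := h1.1
      exact h2 (by simpa [smul_eq_mul, mul_comm] using ha : x • a = x • 0)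
    have hI' : Ideal.span {x} = i.ker.ideal V := by rw [← hI, Ideal.ofList_singleton]
    refine ⟨(V : X.Opens), hzV, PUnit.{u + 1}, inferInstance, ?_⟩
    exact nonempty_free_iso_over_idealModule_of_span_singleton i V x hx hI'
  · -- off the closed image the ideal is the unit ideal
    have hopen : IsOpen (Set.range i.base)ᶜ := i.isClosedEmbedding.isClosed_range.isOpen_compl
    obtain ⟨_, ⟨V, hV, rfl⟩, hyV, hVsub⟩ := X.isBasis_affineOpens.exists_subset_of_mem_open (Set.mem_compl hy) hopen
    have hempty : i ⁻¹ᵁ V = ⊥ := by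
      ext z
      simp only [Scheme.Hom.coe_preimage, Set.mem_preimage, SetLike.mem_coe, Opens.coe_bot, Set.mem_empty_iff_false, iff_false]
      exact fun hz => hVsub hz ⟨z, rfl⟩
    have hI : Ideal.span {(1 : Γ(X, V))} = i.ker.ideal ⟨V, hV⟩ := by
      rw [Ideal.span_singleton_one, eq_comm, eq_top_iff]
      intro a _
      change a ∈ i.ker.ideal ⟨V, hV⟩
      rw [Scheme.Hom.ker_apply, RingHom.mem_ker]
      have hsub : Subsingleton Γ(Z, i ⁻¹ᵁ V) := by
        rw [hempty]
        exact CommRingCat.subsingleton_of_isTerminal Z.sheaf.isTerminalOfEmpty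
      exact Subsingleton.elim _ _
    refine ⟨V, hyV, PUnit.{u + 1}, inferInstance, ?_⟩
    exact nonempty_free_iso_over_idealModule_of_span_singleton i ⟨V, hV⟩ 1 (fun a ha => by simpa using ha) hI

end Summit.ResolutionOfSingularities.ResolutionOfSingularities.Cruxes.EquisingularLiftNat.F102

end
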